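import Summits.CriticalPhenomena.SAWScalingLimit.Theorems.SAWDevelopingMapObservableToSLECanonicalTransferFamily
import Summits.CriticalPhenomena.SAWScalingLimit.Theorems.SAWDevelopingMapObservableToSLERestrictionCocycleHelpersLattice
import Summits.CriticalPhenomena.SAWScalingLimit.Theorems.SAWDevelopingMapObservableToSLECanonicalTransferAdmissibleBits
import HarnessLib

/-!
# The two-piece admissible family: GATE MID-EDGES (piece (G2-fam-f) of stub T2b″)

Crux `SAWDevelopingMap.ObservableToSLE` (stmt-CriticalPhenomena-10472), line `six-class-type-ladder`,
stub T2b″ `stub_carvedReduction_squeezeSolid`.  Landing target: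
`Summits/CriticalPhenomena/SAWScalingLimit/Theorems/SAWDevelopingMapObservableToSLETypeLadderCarvedReductionSqueezeFamilyGates.lean`
(`--supports stmt-CriticalPhenomena-10472`).  Companion of `…SqueezeFamily` (independent of it).

The admissibility block of ARL″ (and of the moving-carving squeeze) asks, besides the clauses of
`twoPiece_exists_innerFamily`, for PRESCRIBED vertical gate mid-edges `{(g i δ, 0), (g i δ - e₁, 1)}`
(up-face of the threshold row `m i δ` near the gate `p i`; in the squeeze: the pinned gate edges of
the carved domains) to be boundary mid-edges of the family, joined by a self-avoiding walk, with
rescaled mid-points converging to `p i`.  From the EXACT ROWS of the family in `B(p i, ρF/32)` this is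
immediate (`twoPiece_family_gates`, registered as `stub_carvedReduction_twoPieceFamilyGates`): the
up-face is in (row `= m i δ`), the down-face below it is out (row `m i δ - 1`), the two gate edges
are distinct (their faces are near different gates), and the family is connected
(`FloorRatio.nonempty_hexMidEdgeSAW_of_preconnected`).
-/

noncomputable section

open scoped Topology
open Filter Set Metric
open Literature.Probability.LatticeModels (HexVertex hexGraph hexCenter Site)
open Literature.Probability.RandomPlanarGeometry
open Literature.Probability.RandomPlanarGeometry.SAW
open Literature.Probability.Percolation (PathIn)

namespace Summit.CriticalPhenomena.SAWScalingLimit.Theorems.ObservableToSLE.TypeLadder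

open Summit.CriticalPhenomena.SAWScalingLimit.Theorems.ObservableToSLE.FloorRatio

/-- **Gate mid-edges of a family with exact rows.**  Let `L δ` be vertex sets which, eventually,
are connected and have EXACT ROWS `≥ m i δ` in `B(p i, r)` (`i = 0, 1`, `2r ≤ dist (p 0) (p 1)`),
and let `(g i δ, 0)` be up-faces of row `m i δ` (eventually) with `δ c_{(g i δ, 0)} → p i`.  Then,
eventually, the vertical mid-edges `aᵢ = {(g i δ, 0), (g i δ - e₁, 1)}` are boundary mid-edges of
`L δ`, they are joined by a self-avoiding walk of `L δ`, and `δ · mid(aᵢ) → p i`. -/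
theorem twoPiece_family_gates {L : ℝ → Finset HexVertex} {p : Fin 2 → ℂ} {m : Fin 2 → ℝ → ℤ}
    {g : Fin 2 → ℝ → Site 2} {r : ℝ} (hr : 0 < r) (hsep : 2 * r ≤ dist (p 0) (p 1))
    (hconn : ∀ᶠ δ : ℝ in 𝓝[>] 0, (hexGraph.induce (↑(L δ) : Set HexVertex)).Preconnected)
    (hrows : ∀ᶠ δ : ℝ in 𝓝[>] 0, ∀ (i : Fin 2) (v : HexVertex), dist ((δ : ℂ) * hexCenter v) (p i) < r →
      (v ∈ L δ ↔ m i δ ≤ v.1 1))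
    (hg : ∀ i, ∀ᶠ δ : ℝ in 𝓝[>] 0, g i δ 1 = m i δ)
    (hglim : ∀ i, Tendsto (fun δ : ℝ => (δ : ℂ) * hexCenter ((g i δ, 0) : HexVertex)) (𝓝[>] 0) (𝓝 (p i))) :
    (∀ᶠ δ : ℝ in 𝓝[>] 0,
      (∀ i, s(((g i δ, 0) : HexVertex), (g i δ - Pi.single 1 1, 1)) ∈ hexDomainBoundary (L δ)) ∧
      ((g 0 δ, 0) : HexVertex) ∈ L δ ∧ ((g 1 δ, 0) : HexVertex) ∈ L δ ∧
      ((g 0 δ - Pi.single 1 1, 1) : HexVertex) ∉ L δ ∧ ((g 1 δ - Pi.single 1 1, 1) : HexVertex) ∉ L δ ∧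
      s(((g 0 δ, 0) : HexVertex), (g 0 δ - Pi.single 1 1, 1)) ≠
        s(((g 1 δ, 0) : HexVertex), (g 1 δ - Pi.single 1 1, 1)) ∧
      Nonempty (HexMidEdgeSAW (L δ) s(((g 0 δ, 0) : HexVertex), (g 0 δ - Pi.single 1 1, 1))
        s(((g 1 δ, 0) : HexVertex), (g 1 δ - Pi.single 1 1, 1)))) ∧
    (∀ i, Tendsto (fun δ : ℝ => (δ : ℂ) *
      hexMidpoint s(((g i δ, 0) : HexVertex), (g i δ - Pi.single 1 1, 1))) (𝓝[>] 0) (𝓝 (p i))) := by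
  refine ⟨?_, fun i => tendsto_smul_hexMidpoint (hglim i) (Eventually.of_forall fun δ => hexGraph_adj_below _)⟩
  -- the up-faces get within `r/2` of the gates, at positive mesh `≤ r/2`
  have hnear : ∀ i, ∀ᶠ δ : ℝ in 𝓝[>] 0, dist ((δ : ℂ) * hexCenter ((g i δ, 0) : HexVertex)) (p i) < r / 2 :=
    fun i => Metric.tendsto_nhds.1 (hglim i) (r / 2) (by positivity)
  have hδev : ∀ᶠ δ : ℝ in 𝓝[>] 0, δ ∈ Ioc 0 (r / 2) := Ioc_mem_nhdsGT (by positivity)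
  filter_upwards [hconn, hrows, hg 0, hg 1, hnear 0, hnear 1, hδev] with δ hconn hrows hg0 hg1 hn0 hn1 hδ
  have hgδ : ∀ i, g i δ 1 = m i δ := by intro i; fin_cases i; exacts [hg0, hg1]
  have hnδ : ∀ i, dist ((δ : ℂ) * hexCenter ((g i δ, 0) : HexVertex)) (p i) < r / 2 := by
    intro i; fin_cases i; exacts [hn0, hn1]
  -- the gate faces: up-face in, down-face out
  have hup : ∀ i, dist ((δ : ℂ) * hexCenter ((g i δ, 0) : HexVertex)) (p i) < r :=
    fun i => (hnδ i).trans (by linarith)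
  have hdown : ∀ i, dist ((δ : ℂ) * hexCenter ((g i δ - Pi.single 1 1, 1) : HexVertex)) (p i) < r := by
    intro i
    have h1 := dist_smul_hexCenter_le_of_adj hδ.1.le (hexGraph_adj_below (g i δ))
    have h2 := dist_triangle ((δ : ℂ) * hexCenter ((g i δ - Pi.single 1 1, 1) : HexVertex))
      ((δ : ℂ) * hexCenter ((g i δ, 0) : HexVertex)) (p i)
    have h3 := hnδ i
    linarith [hδ.2]
  have hrow_down : ∀ i, ((g i δ - Pi.single 1 1, (1 : Fin 2)) : HexVertex).1 1 < m i δ := by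
    intro i
    have e : ((g i δ - Pi.single 1 1, (1 : Fin 2)) : HexVertex).1 1 = g i δ 1 - 1 := by
      simp [Pi.sub_apply]
    rw [e, hgδ i]
    linarith
  have hrow_up : ∀ i, m i δ ≤ ((g i δ, (0 : Fin 2)) : HexVertex).1 1 := fun i => le_of_eq (hgδ i).symm
  have hupL : ∀ i, ((g i δ, 0) : HexVertex) ∈ L δ := fun i => (hrows i _ (hup i)).2 (hrow_up i)
  have hdownL : ∀ i, ((g i δ - Pi.single 1 1, 1) : HexVertex) ∉ L δ :=
    fun i h => (not_le.2 (hrow_down i)) ((hrows i _ (hdown i)).1 h)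
  -- the two gate mid-edges are distinct (their up-faces are near `p 0`, `p 1`)
  have hfar : ∀ (a b : HexVertex), dist ((δ : ℂ) * hexCenter a) (p 0) < r →
      dist ((δ : ℂ) * hexCenter b) (p 1) < r → a ≠ b := by
    rintro a b ha hb rfl
    have := dist_triangle_left (p 0) (p 1) ((δ : ℂ) * hexCenter a)
    linarith
  have hne : s(((g 0 δ - Pi.single 1 1, 1) : HexVertex), ((g 0 δ, 0) : HexVertex)) ≠
      s(((g 1 δ - Pi.single 1 1, 1) : HexVertex), ((g 1 δ, 0) : HexVertex)) := by
    intro h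
    rw [Sym2.eq_iff] at h
    rcases h with ⟨-, h2⟩ | ⟨h1, -⟩
    · exact hfar _ _ (hup 0) (hup 1) h2
    · exact hfar _ _ (hdown 0) (hup 1) h1
  have hswap : ∀ i, s(((g i δ, 0) : HexVertex), ((g i δ - Pi.single 1 1, 1) : HexVertex)) =
      s(((g i δ - Pi.single 1 1, 1) : HexVertex), ((g i δ, 0) : HexVertex)) := fun i => Sym2.eq_swap
  refine ⟨fun i => (mem_hexDomainBoundary_of_adj (hupL i) (hdownL i) (hexGraph_adj_below (g i δ))).1,
    hupL 0, hupL 1, hdownL 0, hdownL 1, ?_, ?_⟩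
  · rw [hswap 0, hswap 1]; exact hne
  · rw [hswap 0, hswap 1]
    exact nonempty_hexMidEdgeSAW_of_preconnected hconn (hexGraph_adj_below (g 0 δ)).symm
      (hdownL 0) (hupL 0) (hdownL 1) (hupL 1) hne

/-- **Registered sub-goal `stub_carvedReduction_twoPieceFamilyGates`** (crux item
stmt-CriticalPhenomena-10472, stub T2b″ `stub_carvedReduction_squeezeSolid`, piece (G2-fam-f) GATE
MID-EDGES OF A FAMILY WITH EXACT ROWS): registry form of `twoPiece_family_gates`. -/
theorem stub_carvedReduction_twoPieceFamilyGates :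
    ∀ (L : ℝ → Finset HexVertex) (p : Fin 2 → ℂ) (m : Fin 2 → ℝ → ℤ) (g : Fin 2 → ℝ → Site 2) (r : ℝ),
      0 < r → 2 * r ≤ dist (p 0) (p 1) →
      (∀ᶠ δ : ℝ in 𝓝[>] 0, (hexGraph.induce (↑(L δ) : Set HexVertex)).Preconnected) →
      (∀ᶠ δ : ℝ in 𝓝[>] 0, ∀ (i : Fin 2) (v : HexVertex), dist ((δ : ℂ) * hexCenter v) (p i) < r →
        (v ∈ L δ ↔ m i δ ≤ v.1 1)) →
      (∀ i, ∀ᶠ δ : ℝ in 𝓝[>] 0, g i δ 1 = m i δ) →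
      (∀ i, Tendsto (fun δ : ℝ => (δ : ℂ) * hexCenter ((g i δ, 0) : HexVertex)) (𝓝[>] 0) (𝓝 (p i))) →
      (∀ᶠ δ : ℝ in 𝓝[>] 0,
        (∀ i, s(((g i δ, 0) : HexVertex), (g i δ - Pi.single 1 1, 1)) ∈ hexDomainBoundary (L δ)) ∧
        ((g 0 δ, 0) : HexVertex) ∈ L δ ∧ ((g 1 δ, 0) : HexVertex) ∈ L δ ∧
        ((g 0 δ - Pi.single 1 1, 1) : HexVertex) ∉ L δ ∧ ((g 1 δ - Pi.single 1 1, 1) : HexVertex) ∉ L δ ∧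
        s(((g 0 δ, 0) : HexVertex), (g 0 δ - Pi.single 1 1, 1)) ≠
          s(((g 1 δ, 0) : HexVertex), (g 1 δ - Pi.single 1 1, 1)) ∧
        Nonempty (HexMidEdgeSAW (L δ) s(((g 0 δ, 0) : HexVertex), (g 0 δ - Pi.single 1 1, 1))
          s(((g 1 δ, 0) : HexVertex), (g 1 δ - Pi.single 1 1, 1)))) ∧
      (∀ i, Tendsto (fun δ : ℝ => (δ : ℂ) *
        hexMidpoint s(((g i δ, 0) : HexVertex), (g i δ - Pi.single 1 1, 1))) (𝓝[>] 0) (𝓝 (p i))) :=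
  fun _ _ _ _ _ hr hsep hconn hrows hg hglim => twoPiece_family_gates hr hsep hconn hrows hg hglim

end Summit.CriticalPhenomena.SAWScalingLimit.Theorems.ObservableToSLE.TypeLadder

end
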